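import Summits.QuantumAdvantage.QuantumAdvantage.Theorems.SosSandwichTransferPBMachineSplit
import Summits.QuantumAdvantage.QuantumAdvantage.Theorems.SosSandwichTransferPBMachineEncodings
import Summits.QuantumAdvantage.QuantumAdvantage.Theorems.SosSandwichTransferPBTranscriptCongr
import Literature.Computability.Complexity.BakerGillSolovay
import HarnessLib

/-!
# Crux `TransferPB` (stmt-QuantumAdvantage-15238, route SosSandwich), line `birth` — the machine half (M) of the OLD split is unsatisfiable

`Theorems/SosSandwichTransferPBMachineSplit.lean` (`stub_pbOracleSimulation_of_nodeProblem`) asked, as its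
hypothesis (M), for ONE polynomial-time transcript machine `C` with
`C^{A ⊕ g}(x) = [advTree (derivedAdvisor F x g) (machineBudget F x r c k) [] (A) ≥ 1/2]` for ALL inputs `x`,
ALL answer functions `g` and ALL oracles `A`. This file proves **`not_machineHalf_forall_g : ¬ (M)`** by a
hidden-string adversary, so that nobody is seated on (M); the corrected split (answer functions CONSISTENT with
the node-test promise problem only) is `Theorems/SosSandwichTransferPBMachineSplitKept.lean`.

The adversary (for ANY circuit family `F`: width `W = n + ancillas`, `M = 2^W − 1 ≥ 2ⁿ − 1` relevant bits):
run `C` on `x = 0ⁿ` against `A = ∅` and the answer function `g₀` = "BLOCK instances ↦ true, everything else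
↦ false"; the transcript has `≤ q(n) < M` queries, each of which names at most one relevant bit `t` through a
SINGLE instance at the empty path or a MEAN instance at the path `[(t, false)]` (`hit`, `card_hit_le_one`), so
some bit `t` is never named (`exists_unhit`). The answer functions `g_β` (`β = true/false`) that additionally
answer the SINGLE test of `t` at the empty path `true` and the forty MEAN tests at `[(t,false)]` by `β` agree
with `g₀` on the whole transcript, hence produce the same run (`run_eq_of_agree`); but under `g_β` the derived
advisor picks `t` first (the only kept bit), then refuses, and outputs the leaf value `β·40/40`, whose threshold
bit is `β` (`eval_advTree_planted`). So the two required outputs differ — contradiction.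
All proved; no named fact. Source (for the counting step): C. H. Bennett, E. Bernstein, G. Brassard,
U. Vazirani, SIAM J. Comput. 26 (1997), Thm. 3.5 (adversary/hybrid lower bound for unstructured search) —
here in its trivial deterministic form.
-/

-- D-0017: single-conjunct summit ⇒ the duplicate `QuantumAdvantage.QuantumAdvantage` is mandated.
set_option linter.dupNamespace false

noncomputable section

namespace Summit.QuantumAdvantage.QuantumAdvantage.Cruxes.TransferPB.Birth

open Finset Literature.Computability.Cryptography Literature.Computability.Complexity
  Literature.Computability.QuantumComplexity Literature.Computability.QuantumComplexity.ClassicalSimulation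

namespace SimTreePB


/-! ### The planted advisor -/

section Planted

variable {F : QCircuitFamily cliffordT} {x : List Bool} {g : List Bool → Bool} {t : Fin (numOracleBits F x)}

/-- Under answers with all BLOCK tests `true` and the SINGLE tests `true` exactly at `(ρ, s) = ([], t)`, the
kept bits at the empty path are exactly `t`. [folklore] -/
theorem kept_nil_iff (hblk : ∀ (ρ : List (Fin (numOracleBits F x) × Bool)) (u : List Bool), g (encBlock F x ρ u) = true)
    (hsgl : ∀ (ρ : List (Fin (numOracleBits F x) × Bool)) (s : Fin (numOracleBits F x)),
      g (encSingle F x ρ s) = true ↔ ρ = [] ∧ s = t)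
    (s : Fin (numOracleBits F x)) : Kept F x g [] s ↔ s = t := by
  constructor
  · intro h
    exact ((hsgl [] s).1 h.2).2
  · rintro rfl
    exact ⟨fun j _ => hblk [] _, (hsgl [] s).2 ⟨rfl, rfl⟩⟩

/-- … so the derived advisor picks `t` at the empty path. [folklore] -/
theorem pick_nil_eq (hblk : ∀ (ρ : List (Fin (numOracleBits F x) × Bool)) (u : List Bool), g (encBlock F x ρ u) = true)
    (hsgl : ∀ (ρ : List (Fin (numOracleBits F x) × Bool)) (s : Fin (numOracleBits F x)),
      g (encSingle F x ρ s) = true ↔ ρ = [] ∧ s = t) :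
    (derivedAdvisor F x g).pick [] = some t := by
  classical
  have hex : ∃ s : Fin (numOracleBits F x), s ∉ ([] : List (Fin (numOracleBits F x) × Bool)).map Prod.fst ∧
      Kept F x g [] s := ⟨t, by simp, (kept_nil_iff hblk hsgl t).2 rfl⟩
  unfold derivedAdvisor
  dsimp only
  rw [dif_pos hex, Option.some.injEq, Fin.find_eq_iff]
  refine ⟨⟨by simp, (kept_nil_iff hblk hsgl t).2 rfl⟩, fun j hj hpj => ?_⟩
  have := (kept_nil_iff hblk hsgl j).1 hpj.2
  subst this
  exact lt_irrefl _ hj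

/-- … and refuses at the planted path `[(t, false)]` (no SINGLE test there is answered `true`). [folklore] -/
theorem pick_planted_eq
    (hsgl : ∀ (ρ : List (Fin (numOracleBits F x) × Bool)) (s : Fin (numOracleBits F x)),
      g (encSingle F x ρ s) = true ↔ ρ = [] ∧ s = t) :
    (derivedAdvisor F x g).pick [(t, false)] = none := by
  classical
  unfold derivedAdvisor
  dsimp only
  rw [dif_neg]
  rintro ⟨s, -, hkept⟩
  have := ((hsgl _ s).1 hkept.2).1
  simp at this

/-- … so the advised tree below the planted path is a leaf, whatever the budget. [folklore] -/
theorem advTree_planted_eq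
    (hsgl : ∀ (ρ : List (Fin (numOracleBits F x) × Bool)) (s : Fin (numOracleBits F x)),
      g (encSingle F x ρ s) = true ↔ ρ = [] ∧ s = t) (D : ℕ) :
    advTree (derivedAdvisor F x g) D [(t, false)] = .leaf ((derivedAdvisor F x g).val [(t, false)]) := by
  cases D with
  | zero => rfl
  | succ D => exact advTree_succ_of_none _ (pick_planted_eq hsgl)

/-- The leaf value at the planted path when the forty MEAN tests there are all answered `β`. [folklore] -/
theorem val_planted_eq {β : Bool} (hmean : ∀ j : ℕ, g (encMean F x [(t, false)] j) = β) :
    (derivedAdvisor F x g).val [(t, false)] = if β then 1 else 0 := by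
  show (((Icc 1 40).filter fun j => g (encMean F x [(t, false)] j) = true).card : ℝ) / 40 = _
  simp only [hmean]
  cases β <;> simp

/-- The relevant bits of the empty oracle are all `false`. [folklore] -/
theorem oracleBits_empty (s : Fin (numOracleBits F x)) : oracleBits F x (∅ : Set (List Bool)) s = false := by
  unfold oracleBits restrictBool
  simp

/-- **The planted tree's threshold bit is `β`.** [folklore] -/
theorem eval_advTree_planted {β : Bool}
    (hblk : ∀ (ρ : List (Fin (numOracleBits F x) × Bool)) (u : List Bool), g (encBlock F x ρ u) = true)
    (hsgl : ∀ (ρ : List (Fin (numOracleBits F x) × Bool)) (s : Fin (numOracleBits F x)),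
      g (encSingle F x ρ s) = true ↔ ρ = [] ∧ s = t)
    (hmean : ∀ j : ℕ, g (encMean F x [(t, false)] j) = β) {D : ℕ} (hD : 0 < D) :
    decide ((1 : ℝ) / 2 ≤ (advTree (derivedAdvisor F x g) D []).eval (oracleBits F x (∅ : Set (List Bool)))) = β := by
  obtain ⟨D, rfl⟩ := Nat.exists_eq_add_of_le' hD
  have htree : advTree (derivedAdvisor F x g) (D + 1) [] =
      .query t (advTree (derivedAdvisor F x g) D ([] ++ [(t, false)]))
        (advTree (derivedAdvisor F x g) D ([] ++ [(t, true)])) :=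
    advTree_succ_of_some _ (pick_nil_eq hblk hsgl)
  rw [htree, RealDecisionTree.eval, oracleBits_empty]
  simp only [Bool.false_eq_true, ↓reduceIte, List.nil_append]
  rw [advTree_planted_eq hsgl, RealDecisionTree.eval, val_planted_eq hmean]
  cases β
  · simp
  · simp only [↓reduceIte, decide_eq_true_eq]
    norm_num

end Planted

/-! ### The adversary's answer functions -/

section Answers

variable {F : QCircuitFamily cliffordT} {x : List Bool} {t : Fin (numOracleBits F x)} {β : Bool}
  {g g₀ : List Bool → Bool}

open scoped Classical in
/-- The planted answer function `g_β` ("BLOCK ↦ true; SINGLE⟨x,[],t⟩ ↦ true; MEAN⟨x,[(t,false)],j⟩ ↦ β; else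
false") answers all blocks `true`, the single tests `true` exactly at `([], t)`, and the planted means by `β`.
[folklore] -/
theorem planted_props
    (hg : ∀ v : List Bool, g v =
      if (∃ (ρ' : List (Fin (numOracleBits F x) × Bool)) (u' : List Bool), v = encBlock F x ρ' u') then true
      else if v = encSingle F x [] t then true
      else if (∃ j : ℕ, v = encMean F x [(t, false)] j) then β else false) :
    (∀ (ρ : List (Fin (numOracleBits F x) × Bool)) (u : List Bool), g (encBlock F x ρ u) = true) ∧
    (∀ (ρ : List (Fin (numOracleBits F x) × Bool)) (s : Fin (numOracleBits F x)),
      g (encSingle F x ρ s) = true ↔ ρ = [] ∧ s = t) ∧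
    (∀ j : ℕ, g (encMean F x [(t, false)] j) = β) := by
  refine ⟨fun ρ u => ?_, fun ρ s => ?_, fun j => ?_⟩
  · rw [hg, if_pos ⟨ρ, u, rfl⟩]
  · rw [hg, if_neg (by rintro ⟨ρ', u', h⟩; exact encBlock_ne_encSingle h.symm)]
    by_cases h : encSingle F x ρ s = encSingle F x [] t
    · rw [if_pos h]
      simp [encSingle_eq_iff.1 h]
    · rw [if_neg h, if_neg (by rintro ⟨j, hj⟩; exact encSingle_ne_encMean hj)]
      simp only [Bool.false_eq_true, false_iff, not_and]
      rintro rfl rfl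
      exact h rfl
  · rw [hg, if_neg (by rintro ⟨ρ', u', h⟩; exact encBlock_ne_encMean h.symm),
      if_neg (fun h => encSingle_ne_encMean h.symm), if_pos ⟨j, rfl⟩]

open scoped Classical in
/-- `g_β` agrees with the base answer function `g₀` ("BLOCK ↦ true; else false") away from the planted
instances. [folklore] -/
theorem planted_agree
    (hg : ∀ v : List Bool, g v =
      if (∃ (ρ' : List (Fin (numOracleBits F x) × Bool)) (u' : List Bool), v = encBlock F x ρ' u') then true
      else if v = encSingle F x [] t then true
      else if (∃ j : ℕ, v = encMean F x [(t, false)] j) then β else false)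
    (hg₀ : ∀ v : List Bool, g₀ v =
      if (∃ (ρ' : List (Fin (numOracleBits F x) × Bool)) (u' : List Bool), v = encBlock F x ρ' u') then true
      else false)
    {v : List Bool} (h1 : v ≠ encSingle F x [] t) (h2 : ∀ j : ℕ, v ≠ encMean F x [(t, false)] j) :
    g₀ v = g v := by
  rw [hg, hg₀]
  by_cases hb : ∃ (ρ' : List (Fin (numOracleBits F x) × Bool)) (u' : List Bool), v = encBlock F x ρ' u'
  · rw [if_pos hb, if_pos hb]
  · rw [if_neg hb, if_neg hb, if_neg h1, if_neg (by rintro ⟨j, hj⟩; exact h2 j hj)]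

end Answers

/-! ### Few queries name few bits -/

section Hit

variable (F : QCircuitFamily cliffordT) (x : List Bool)

open scoped Classical in
/-- A query names at most one relevant bit through a SINGLE instance at the empty path or a MEAN instance at a
planted path (encodings are injective and of distinct kinds). [folklore] -/
theorem card_hit_le_one (w : List Bool) :
    (univ.filter fun s : Fin (numOracleBits F x) =>
      w = true :: encSingle F x [] s ∨ ∃ j : ℕ, w = true :: encMean F x [(s, false)] j).card ≤ 1 := by
  rw [Finset.card_le_one]
  intro s hs s' hs'
  simp only [mem_filter, mem_univ, true_and] at hs hs'
  rcases hs with hs | ⟨j, hs⟩ <;> rcases hs' with hs' | ⟨j', hs'⟩ <;> rw [hs] at hs' <;>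
    simp only [List.cons.injEq, true_and] at hs'
  · exact (encSingle_eq_iff.1 hs').2
  · exact absurd hs' encSingle_ne_encMean
  · exact absurd hs'.symm encSingle_ne_encMean
  · have h := (encMean_eq_iff.1 hs').1
    simpa using h

open scoped Classical in
/-- **Fewer queries than relevant bits leave a bit unnamed.** [cite: BennettBernsteinBrassardVazirani1997, Thm. 3.5 (deterministic special case)] -/
theorem exists_unhit (T : List (List Bool)) (hT : T.length < numOracleBits F x) :
    ∃ t : Fin (numOracleBits F x),
      (true :: encSingle F x [] t) ∉ T ∧ ∀ j : ℕ, (true :: encMean F x [(t, false)] j) ∉ T := by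
  set S : Finset (Fin (numOracleBits F x)) := T.toFinset.biUnion fun w => univ.filter
      fun s : Fin (numOracleBits F x) => w = true :: encSingle F x [] s ∨ ∃ j : ℕ, w = true :: encMean F x [(s, false)] j
    with hS
  have hcard : S.card < (univ : Finset (Fin (numOracleBits F x))).card := by
    calc S.card ≤ ∑ w ∈ T.toFinset, (univ.filter fun s : Fin (numOracleBits F x) =>
            w = true :: encSingle F x [] s ∨ ∃ j : ℕ, w = true :: encMean F x [(s, false)] j).card :=
          Finset.card_biUnion_le
      _ ≤ ∑ _w ∈ T.toFinset, 1 := Finset.sum_le_sum fun w _ => card_hit_le_one F x w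
      _ = T.toFinset.card := by simp
      _ ≤ T.length := List.toFinset_card_le T
      _ < numOracleBits F x := hT
      _ = (univ : Finset (Fin (numOracleBits F x))).card := by simp
  obtain ⟨t, -, ht⟩ := Finset.exists_mem_notMem_of_card_lt_card hcard
  refine ⟨t, fun hmem => ht ?_, fun j hmem => ht ?_⟩
  · exact Finset.mem_biUnion.2 ⟨_, List.mem_toFinset.2 hmem, mem_filter.2 ⟨mem_univ _, Or.inl rfl⟩⟩
  · exact Finset.mem_biUnion.2 ⟨_, List.mem_toFinset.2 hmem, mem_filter.2 ⟨mem_univ _, Or.inr ⟨j, rfl⟩⟩⟩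

end Hit

/-! ### The refutation -/

/-- **No transcript machine reproduces the derived advisor's tree for ALL answer functions** — for ANY circuit
family `F` (uniform or not, oracle gates or not), constants `c, k` and polynomial `r`, and any round budget
polynomial `q` (polynomial TIME is not even needed): a hidden-string adversary defeats it on `x = 0ⁿ` as soon as
`q(n) + 2 < 2ⁿ`. [cite: BennettBernsteinBrassardVazirani1997, Thm. 3.5 (deterministic special case)] -/
theorem machineHalf_fails (c k : ℕ) (F : QCircuitFamily cliffordT) (r : Polynomial ℕ) :
    ¬ ∃ (C : OracleAlg Bool) (q : Polynomial ℕ),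
        ∀ (x : List Bool) (g : List Bool → Bool) (A : Set (List Bool)),
          C.run (Oracle.ofLanguage {w : List Bool | ∃ v : List Bool,
              (w = false :: v ∧ v ∈ A) ∨ (w = true :: v ∧ g v = true)}) (q.eval x.length) x =
            some (decide (1 / 2 ≤
              (advTree (derivedAdvisor F x g) (machineBudget F x r c k) []).eval (oracleBits F x A))) := by
  classical
  rintro ⟨C, q, hrun⟩
  obtain ⟨n, -, hn⟩ := BGS.exists_lt_two_pow (q + 2) 0
  set x : List Bool := List.replicate n false with hx
  have hxlen : x.length = n := by simp [hx]
  have hM : q.eval n < numOracleBits F x := by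
    rw [numOracleBits_eq]
    have hW : oracleWidth F x = n + F.ancillas n := by simp [oracleWidth, hxlen]
    rw [hW]
    have h2 : (q + 2).eval n = q.eval n + 2 := by simp
    rw [h2] at hn
    have : 2 ^ n ≤ 2 ^ (n + F.ancillas n) := Nat.pow_le_pow_right (by norm_num) (Nat.le_add_right _ _)
    omega
  -- the base answer function, its oracle and its transcript
  set g₀ : List Bool → Bool := fun v =>
    if (∃ (ρ' : List (Fin (numOracleBits F x) × Bool)) (u' : List Bool), v = encBlock F x ρ' u')
    then true else false with hg₀def
  have hg₀ : ∀ v : List Bool, g₀ v =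
      if (∃ (ρ' : List (Fin (numOracleBits F x) × Bool)) (u' : List Bool), v = encBlock F x ρ' u')
      then true else false := fun _ => rfl
  set O₀ : Oracle := Oracle.ofLanguage {w : List Bool | ∃ v : List Bool,
      (w = false :: v ∧ v ∈ (∅ : Set (List Bool))) ∨ (w = true :: v ∧ g₀ v = true)} with hO₀
  set T := C.queries O₀ (q.eval x.length) x with hT
  have hTlen : T.length < numOracleBits F x :=
    (OracleAlg.length_queries_le _ _ _ _).trans_lt (by rwa [hxlen])
  obtain ⟨t, ht1, ht2⟩ := exists_unhit F x T hTlen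
  -- the two planted answer functions
  set gb : Bool → List Bool → Bool := fun β v =>
    if (∃ (ρ' : List (Fin (numOracleBits F x) × Bool)) (u' : List Bool), v = encBlock F x ρ' u')
    then true
    else if v = encSingle F x [] t then true
    else if (∃ j : ℕ, v = encMean F x [(t, false)] j) then β else false with hgbdef
  have hgb : ∀ (β : Bool) (v : List Bool), gb β v =
      if (∃ (ρ' : List (Fin (numOracleBits F x) × Bool)) (u' : List Bool), v = encBlock F x ρ' u')
      then true
      else if v = encSingle F x [] t then true
      else if (∃ j : ℕ, v = encMean F x [(t, false)] j) then β else false := fun _ _ => rfl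
  -- same transcript, same run
  have hsame : ∀ β : Bool,
      C.run (Oracle.ofLanguage {w : List Bool | ∃ v : List Bool,
          (w = false :: v ∧ v ∈ (∅ : Set (List Bool))) ∨ (w = true :: v ∧ gb β v = true)}) (q.eval x.length) x =
        C.run O₀ (q.eval x.length) x := by
    intro β
    refine (run_eq_of_agree C fun w hw => ?_).symm
    refine combinedOracle_eq_of ∅ fun v hv => ?_
    refine planted_agree (hgb β) hg₀ ?_ ?_
    · rintro rfl
      exact ht1 (hv ▸ hw)
    · rintro j rfl
      exact ht2 j (hv ▸ hw)
  -- but the two required outputs differ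
  have hD : 0 < machineBudget F x r c k := Nat.succ_pos _
  have hout : ∀ β : Bool, C.run O₀ (q.eval x.length) x = some β := by
    intro β
    obtain ⟨hblk, hsgl, hmean⟩ := planted_props (hgb β)
    rw [← hsame β, hrun x (gb β) ∅, eval_advTree_planted hblk hsgl hmean hD]
  have := (hout true).symm.trans (hout false)
  simp at this

/-- **Hence the hypothesis (M) of `stub_pbOracleSimulation_of_nodeProblem` is false** (given any uniform
Clifford+T family, e.g. the Hadamard coin family `PostBPPSim.hadFamily` of
`Literature/Computability/Cryptography/PostselectionPostBQPProofs.lean`, `hadFamily_isUniform`): the old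
split is vacuous and the machine half must be stated for CONSISTENT answer functions
(`Theorems/SosSandwichTransferPBMachineSplitKept.lean`). [cite: BennettBernsteinBrassardVazirani1997, Thm. 3.5 (deterministic special case)] -/
theorem not_machineHalf_forall_g (F₀ : QCircuitFamily cliffordT) (hF₀ : F₀.IsUniform) :
    ¬ (∀ (c k : ℕ) (F : QCircuitFamily cliffordT), F.IsUniform → ∀ r : Polynomial ℕ,
      ∃ (C : OracleAlg Bool) (q : Polynomial ℕ),
        C.IsPolyTime Computability.encodingBoolBool ∧
        (∀ (O : Oracle) (x : List Bool), ∀ y ∈ C.queries O (q.eval x.length) x, y.length ≤ q.eval x.length) ∧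
        ∀ (x : List Bool) (g : List Bool → Bool) (A : Set (List Bool)),
          C.run (Oracle.ofLanguage {w : List Bool | ∃ v : List Bool,
              (w = false :: v ∧ v ∈ A) ∨ (w = true :: v ∧ g v = true)}) (q.eval x.length) x =
            some (decide (1 / 2 ≤
              (advTree (derivedAdvisor F x g) (machineBudget F x r c k) []).eval (oracleBits F x A)))) := by
  intro h
  obtain ⟨C, q, -, -, hrun⟩ := h 0 0 F₀ hF₀ 0
  exact machineHalf_fails 0 0 F₀ 0 ⟨C, q, hrun⟩

end SimTreePB

end Summit.QuantumAdvantage.QuantumAdvantage.Cruxes.TransferPB.Birth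

end
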